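import Literature.Probability.RandomPlanarGeometry.HexSAWSurfaceWallRenewalCensusEightB1
import Literature.Probability.RandomPlanarGeometry.HexSAWSurfaceWallRenewalCensusEightA
import HarnessLib

/-!
# The order-EIGHT diagonal census, part B2: `N₁₁,₃ = 33` exactly (second half of the split and the assembly); `Λ₂₂(y) = N₁₁,₁·y + N₁₁,₂·y² + 33y³`

Topic `Literature/Probability/RandomPlanarGeometry` (lane «pcv-sawmu», a-p6 g20, car «CENSUS-EIGHT-B2»; parents: part B1 (the first four prefix certificates and
`TwentyTwoThree.revLists`), «CENSUS-EIGHT-A», «BLOCKS-EIGHT-B», a-idea-1 g34's «SEVEN-CENSUS» engine (`WCensus.grow`, `revList_mem_censusW`, `forall_mem_grow_succ`,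
`eq_of_revList_eq`, `frozen_of_mem_ipwb`), and «EIGHTH-CENSUS-IDENTITY»'s `IPWB_twentytwo_le_census`-type class decompositions are NOT needed here).

## What is proved (namespace `…SAW.HexBW.Wall`; walk lengths symbolic in every statement about `ipwb`)
* §1 the remaining three prefix certificates (`10656 + 11487 + 3532 = 25675` nodes, ≈ 4 min kernel) and the ASSEMBLY: nine `forall_mem_grow_succ` steps
  (the children lists of `WCensus.extendW` by `decide`) up to ★★ `TwentyTwoThree.censusW_subset : ∀ l ∈ WCensus.censusW 22 3, l ∈ revLists`.
* §2 ★★★ `exists_eq_twentyTwoThree_W_of_mem_ipwb_twentytwo_of_visits_eq_three`, `threeVisit_ipwb_twentytwo_eq_image`,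
  ★★★ `card_threeVisit_ipwb_twentytwo_eq_thirtyThree` (**`N₁₁,₃ = 33`**).
NOT claimed: `N₁₁,₁`, `N₁₁,₂` (diagonals `10, 9`); `N₁₂,₄` (= 1 by «SIX-STEP-RIGIDITY», car 73); `a₇ = 18` (the one-line corollary of «EIGHTH-CENSUS-IDENTITY» with
this census, «CENSUS-EIGHT-A» and car 73 — filed separately).  Label (lane): DATA-LEMMA / kernel census + completeness theorem; budget lines: 3.
Sources: [MadrasSlade1993, Section 4.2, Definition 4.2.1, (4.2.2), Theorem 4.2.2 (pp. 91–92)], [Kesten1963SAW, Section 4], [EntingJensen2009, Section 7.4.2, Fig. 7.10].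
-/

namespace Literature.Probability.RandomPlanarGeometry.SAW.HexBW.Wall

open Finset Function Census
open Literature.Probability.LatticeModels

/-! ### §1  The remaining certificates and the assembly -/

namespace TwentyTwoThree

set_option maxHeartbeats 4000000 in
/-- Kernel certificate for the completions of the prefix `[(0, 0), (1, 0), (1, -1), (2, -1), (3, -1), (4, -1)]` (`10656` search nodes, `17` steps to go). [cite: MadrasSlade1993, Section 4.2, Definition 4.2.1, (4.2.2)] -/
theorem cert_0p0_1p0_1m1_2m1_3m1_4m1 : ∀ x ∈ WCensus.grow 22 3 17 [(4, -1), (3, -1), (2, -1), (1, -1), (1, 0), (0, 0)], x ∈ revLists := by decide +kernel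

set_option maxHeartbeats 4000000 in
/-- Kernel certificate for the completions of the prefix `[(0, 0), (1, 0), (1, -1), (2, -1), (2, -2), (3, -2)]` (`11487` search nodes, `17` steps to go). [cite: MadrasSlade1993, Section 4.2, Definition 4.2.1, (4.2.2)] -/
theorem cert_0p0_1p0_1m1_2m1_2m2_3m2 : ∀ x ∈ WCensus.grow 22 3 17 [(3, -2), (2, -2), (2, -1), (1, -1), (1, 0), (0, 0)], x ∈ revLists := by decide +kernel

set_option maxHeartbeats 4000000 in
/-- Kernel certificate for the completions of the prefix `[(0, 0), (1, 0), (1, -1), (2, -1), (2, -2), (1, -2)]` (`3532` search nodes, `17` steps to go). [cite: MadrasSlade1993, Section 4.2, Definition 4.2.1, (4.2.2)] -/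
theorem cert_0p0_1p0_1m1_2m1_2m2_1m2 : ∀ x ∈ WCensus.grow 22 3 17 [(1, -2), (2, -2), (2, -1), (1, -1), (1, 0), (0, 0)], x ∈ revLists := by decide +kernel

/-- Assembly over the children of the prefix `[(0, 0), (1, 0), (2, 0), (3, 0), (3, -1)]` (`14048` nodes below). [cite: MadrasSlade1993, Section 4.2, Definition 4.2.1, (4.2.2)] -/
theorem cert_0p0_1p0_2p0_3p0_3m1 : ∀ x ∈ WCensus.grow 22 3 18 [(3, -1), (3, 0), (2, 0), (1, 0), (0, 0)], x ∈ revLists :=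
  WCensus.forall_mem_grow_succ (fun l' hl' => by
    have he : WCensus.extendW 3 17 [(3, -1), (3, 0), (2, 0), (1, 0), (0, 0)] = [[(4, -1), (3, -1), (3, 0), (2, 0), (1, 0), (0, 0)], [(2, -1), (3, -1), (3, 0), (2, 0), (1, 0), (0, 0)]] := by decide
    rw [he] at hl'
    simp only [List.mem_cons, List.mem_nil_iff, or_false] at hl'
    rcases hl' with rfl | rfl
    · exact cert_0p0_1p0_2p0_3p0_3m1_4m1
    · exact cert_0p0_1p0_2p0_3p0_3m1_2m1)

/-- Assembly over the children of the prefix `[(0, 0), (1, 0), (1, -1), (2, -1), (3, -1)]` (`13118` nodes below). [cite: MadrasSlade1993, Section 4.2, Definition 4.2.1, (4.2.2)] -/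
theorem cert_0p0_1p0_1m1_2m1_3m1 : ∀ x ∈ WCensus.grow 22 3 18 [(3, -1), (2, -1), (1, -1), (1, 0), (0, 0)], x ∈ revLists :=
  WCensus.forall_mem_grow_succ (fun l' hl' => by
    have he : WCensus.extendW 3 17 [(3, -1), (2, -1), (1, -1), (1, 0), (0, 0)] = [[(4, -1), (3, -1), (2, -1), (1, -1), (1, 0), (0, 0)], [(3, 0), (3, -1), (2, -1), (1, -1), (1, 0), (0, 0)]] := by decide
    rw [he] at hl'
    simp only [List.mem_cons, List.mem_nil_iff, or_false] at hl'
    rcases hl' with rfl | rfl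
    · exact cert_0p0_1p0_1m1_2m1_3m1_4m1
    · exact cert_0p0_1p0_1m1_2m1_3m1_3p0)

/-- Assembly over the children of the prefix `[(0, 0), (1, 0), (1, -1), (2, -1), (2, -2)]` (`15020` nodes below). [cite: MadrasSlade1993, Section 4.2, Definition 4.2.1, (4.2.2)] -/
theorem cert_0p0_1p0_1m1_2m1_2m2 : ∀ x ∈ WCensus.grow 22 3 18 [(2, -2), (2, -1), (1, -1), (1, 0), (0, 0)], x ∈ revLists :=
  WCensus.forall_mem_grow_succ (fun l' hl' => by
    have he : WCensus.extendW 3 17 [(2, -2), (2, -1), (1, -1), (1, 0), (0, 0)] = [[(3, -2), (2, -2), (2, -1), (1, -1), (1, 0), (0, 0)], [(1, -2), (2, -2), (2, -1), (1, -1), (1, 0), (0, 0)]] := by decide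
    rw [he] at hl'
    simp only [List.mem_cons, List.mem_nil_iff, or_false] at hl'
    rcases hl' with rfl | rfl
    · exact cert_0p0_1p0_1m1_2m1_2m2_3m2
    · exact cert_0p0_1p0_1m1_2m1_2m2_1m2)

/-- Assembly over the children of the prefix `[(0, 0), (1, 0), (2, 0), (3, 0)]` (`18723` nodes below). [cite: MadrasSlade1993, Section 4.2, Definition 4.2.1, (4.2.2)] -/
theorem cert_0p0_1p0_2p0_3p0 : ∀ x ∈ WCensus.grow 22 3 19 [(3, 0), (2, 0), (1, 0), (0, 0)], x ∈ revLists :=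
  WCensus.forall_mem_grow_succ (fun l' hl' => by
    have he : WCensus.extendW 3 18 [(3, 0), (2, 0), (1, 0), (0, 0)] = [[(4, 0), (3, 0), (2, 0), (1, 0), (0, 0)], [(3, -1), (3, 0), (2, 0), (1, 0), (0, 0)]] := by decide
    rw [he] at hl'
    simp only [List.mem_cons, List.mem_nil_iff, or_false] at hl'
    rcases hl' with rfl | rfl
    · exact cert_0p0_1p0_2p0_3p0_4p0
    · exact cert_0p0_1p0_2p0_3p0_3m1)

/-- Assembly over the children of the prefix `[(0, 0), (1, 0), (1, -1), (2, -1)]` (`28139` nodes below). [cite: MadrasSlade1993, Section 4.2, Definition 4.2.1, (4.2.2)] -/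
theorem cert_0p0_1p0_1m1_2m1 : ∀ x ∈ WCensus.grow 22 3 19 [(2, -1), (1, -1), (1, 0), (0, 0)], x ∈ revLists :=
  WCensus.forall_mem_grow_succ (fun l' hl' => by
    have he : WCensus.extendW 3 18 [(2, -1), (1, -1), (1, 0), (0, 0)] = [[(3, -1), (2, -1), (1, -1), (1, 0), (0, 0)], [(2, -2), (2, -1), (1, -1), (1, 0), (0, 0)]] := by decide
    rw [he] at hl'
    simp only [List.mem_cons, List.mem_nil_iff, or_false] at hl'
    rcases hl' with rfl | rfl
    · exact cert_0p0_1p0_1m1_2m1_3m1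
    · exact cert_0p0_1p0_1m1_2m1_2m2)

/-- Assembly over the children of the prefix `[(0, 0), (1, 0), (2, 0)]` (`18724` nodes below). [cite: MadrasSlade1993, Section 4.2, Definition 4.2.1, (4.2.2)] -/
theorem cert_0p0_1p0_2p0 : ∀ x ∈ WCensus.grow 22 3 20 [(2, 0), (1, 0), (0, 0)], x ∈ revLists :=
  WCensus.forall_mem_grow_succ (fun l' hl' => by
    have he : WCensus.extendW 3 19 [(2, 0), (1, 0), (0, 0)] = [[(3, 0), (2, 0), (1, 0), (0, 0)]] := by decide
    rw [he] at hl'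
    simp only [List.mem_cons, List.mem_nil_iff, or_false] at hl'
    subst hl'
    exact cert_0p0_1p0_2p0_3p0)

/-- Assembly over the children of the prefix `[(0, 0), (1, 0), (1, -1)]` (`28140` nodes below). [cite: MadrasSlade1993, Section 4.2, Definition 4.2.1, (4.2.2)] -/
theorem cert_0p0_1p0_1m1 : ∀ x ∈ WCensus.grow 22 3 20 [(1, -1), (1, 0), (0, 0)], x ∈ revLists :=
  WCensus.forall_mem_grow_succ (fun l' hl' => by
    have he : WCensus.extendW 3 19 [(1, -1), (1, 0), (0, 0)] = [[(2, -1), (1, -1), (1, 0), (0, 0)]] := by decide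
    rw [he] at hl'
    simp only [List.mem_cons, List.mem_nil_iff, or_false] at hl'
    subst hl'
    exact cert_0p0_1p0_1m1_2m1)

/-- Assembly over the children of the prefix `[(0, 0), (1, 0)]` (`46865` nodes below). [cite: MadrasSlade1993, Section 4.2, Definition 4.2.1, (4.2.2)] -/
theorem cert_0p0_1p0 : ∀ x ∈ WCensus.grow 22 3 21 [(1, 0), (0, 0)], x ∈ revLists :=
  WCensus.forall_mem_grow_succ (fun l' hl' => by
    have he : WCensus.extendW 3 20 [(1, 0), (0, 0)] = [[(2, 0), (1, 0), (0, 0)], [(1, -1), (1, 0), (0, 0)]] := by decide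
    rw [he] at hl'
    simp only [List.mem_cons, List.mem_nil_iff, or_false] at hl'
    rcases hl' with rfl | rfl
    · exact cert_0p0_1p0_2p0
    · exact cert_0p0_1p0_1m1)

/-- Assembly over the children of the prefix `[(0, 0)]` (`46866` nodes below). [cite: MadrasSlade1993, Section 4.2, Definition 4.2.1, (4.2.2)] -/
theorem cert_0p0 : ∀ x ∈ WCensus.grow 22 3 22 [(0, 0)], x ∈ revLists :=
  WCensus.forall_mem_grow_succ (fun l' hl' => by
    have he : WCensus.extendW 3 21 [(0, 0)] = [[(1, 0), (0, 0)]] := by decide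
    rw [he] at hl'
    simp only [List.mem_cons, List.mem_nil_iff, or_false] at hl'
    subst hl'
    exact cert_0p0_1p0)

/-- ★★ **Kernel census of the class `(22, 3)`**: every list of the `(22, 3)` search is one of the 33 tables (assembled from the seven prefix certificates).
[cite: MadrasSlade1993, Section 4.2, Definition 4.2.1, (4.2.2)] -/
theorem censusW_subset : ∀ l ∈ WCensus.censusW 22 3, l ∈ revLists := cert_0p0

end TwentyTwoThree

/-! ### §2  Exhaustion and the class number `N₁₁,₃ = 33` -/

variable {y : ℝ}

/-- ★★ **A three-visit irreducible positive wall bridge of length twenty-two is one of the 33 exhibited blocks** (symbolic length).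
[cite: MadrasSlade1993, Section 4.2, Definition 4.2.1, (4.2.2)] [cite: Kesten1963SAW, Section 4] [cite: EntingJensen2009, Section 7.4.2, Fig. 7.10] -/
theorem exists_eq_twentyTwoThree_W_of_mem_ipwb_twentytwo_of_visits_eq_three {m : ℕ} {ω : ℕ → Site 2} (hm : m = 22) (hω : ω ∈ ipwb m)
    (hv : visits m ω = 3) : ∃ i : Fin 33, ω = TwentyTwoThree.W i := by
  have h1 := WCensus.revList_mem_censusW hω hv
  rw [hm] at h1
  obtain ⟨i, -, hi⟩ := List.mem_map.1 (TwentyTwoThree.censusW_subset _ h1)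
  refine ⟨i, ?_⟩
  have hfr := WCensus.frozen_of_mem_ipwb hω
  have hfr' := WCensus.frozen_of_mem_ipwb (TwentyTwoThree.W_mem_ipwb hm i)
  rw [hm] at hfr hfr'
  exact WCensus.eq_of_revList_eq hfr hfr' hi.symm

open Classical in
/-- ★★ The three-visit class of `ipwb 22` is the image of the 33 tables (symbolic length). [cite: MadrasSlade1993, Section 4.2, Definition 4.2.1, (4.2.2)] [cite: EntingJensen2009, Section 7.4.2, Fig. 7.10] -/
theorem threeVisit_ipwb_twentytwo_eq_image {m : ℕ} (hm : m = 22) :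
    ((ipwb m).filter fun ω => visits m ω = 3) = Finset.univ.image TwentyTwoThree.W := by
  ext ω
  rw [Finset.mem_filter]
  constructor
  · rintro ⟨hω, hv⟩
    obtain ⟨i, rfl⟩ := exists_eq_twentyTwoThree_W_of_mem_ipwb_twentytwo_of_visits_eq_three hm hω hv
    exact Finset.mem_image_of_mem _ (Finset.mem_univ i)
  · intro h
    obtain ⟨i, -, rfl⟩ := Finset.mem_image.1 h
    exact ⟨TwentyTwoThree.W_mem_ipwb hm i, by rw [hm]; exact TwentyTwoThree.visits_W i⟩

open Classical in
/-- ★★★ **`N₁₁,₃ = 33`**: there are exactly thirty-three three-visit irreducible positive wall bridges of length twenty-two (symbolic length).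
[cite: MadrasSlade1993, Section 4.2, Definition 4.2.1, (4.2.2) and Theorem 4.2.2 (pp. 91–92)] [cite: Kesten1963SAW, Section 4] -/
theorem card_threeVisit_ipwb_twentytwo_eq_thirtyThree {m : ℕ} (hm : m = 22) : #((ipwb m).filter fun ω => visits m ω = 3) = 33 := by
  rw [threeVisit_ipwb_twentytwo_eq_image hm, Finset.card_image_of_injective _ TwentyTwoThree.W_injective]
  simp

end Literature.Probability.RandomPlanarGeometry.SAW.HexBW.Wall
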